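import Literature.Computability.Cryptography.PseudorandomGeneratorsAnyOWF
import Literature.Computability.Cryptography.IndistinguishabilityProofs
import Literature.Computability.MetaComplexity.DistProblems
import Literature.Computability.Complexity.PairProjections
import Literature.Probability.LatticeModels.IndependencePolynomial

/-!
# Clause (i): index-free PPT tests on indistinguishable fixed-length ensembles
(stub `stub_clauseI` of line `prg-image-exact-threshold-lift`)

Crux `Summit.PneNP.PneNP.Theses.PhaseTwins.PseudorandomTwinsAbove` (item stmt-PneNP-2721), step S5.

`IsCompIndistinguishable X Y` feeds a distinguisher the game input
`⟨1ⁿ, x⟩ = boolPair (unaryEncodeNat n) x` and asks for negligible advantage; clause (i) of the crux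
concerns INDEX-FREE tests `A` (input `x` alone, coin budget `A.coinLen |x|`) and asks only that
the acceptance gap tends to `0`. For ensembles of FIXED LENGTH (`X n`, `Y n` supported on
`{0,1}^{ℓ' n}`) with `ℓ'` strictly monotone, the index-free test `A` is simulated by an index-fed
distinguisher `D`: `D.run z r = A.run (boolUnpair z).2 r`, and on game-input length
`m = 2n + 2 + ℓ' n` (the `n` is unique since `n ↦ 2n + 2 + ℓ' n` is strictly monotone) the coin
budget `D.coinLen m = A.coinLen (ℓ' n)` (a length selector `g` with `g (2n + 2 + ℓ' n) = ℓ' n`,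
`g m ≤ m`, `ClauseI.exists_lenSel`). Such a `D` is PPT (`ClauseI.isPPT_of_run_eq`: second pair
projection `boolUnpairSnd_mem_FP`, `mapFstFn_mem_FP`, `PolyTimeComputable.comp_holds`; the coin
polynomial of `A` is monotone and `g m ≤ m`), its output law on `⟨1ⁿ, x⟩` with `|x| = ℓ' n` is that
of `A` on `x` (`ClauseI.outputPMF_of_run_eq`), so its acceptance probability on `X n` is
`∑' x, (X n x) · Pr[A(x) = 1]` (`ClauseI.acceptPMF_toReal_of_run_eq`) and its advantage IS the
gap of clause (i) (`ClauseI.distAdvantage_of_run_eq`); negligible functions tend to `0`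
(exponent `0` of `SuperpolynomialDecay`).

This mirrors, in the other direction, the `PRGTake.lift`/`lenClass` device of
`Literature/Computability/Cryptography/PseudorandomGeneratorsStretchOne.lean`.
No definitions, no named facts; everything used is proved in the tree.
-/

set_option linter.dupNamespace false -- `Summit.PneNP.PneNP.…`: summit = sub-problem (D-0017)

namespace Summit.PneNP.PneNP.Theorems

open Filter
open Literature.Computability.Complexity Literature.Computability.MetaComplexity
open Literature.Computability.Cryptography (OWFExist PRGExist IsPRG IsCompIndistinguishable uniformBits
  PRGExist_of_OWFExist)
open Literature.Probability.LatticeModels (hardCoreThreshold)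
open _root_.Computability

namespace ClauseI

open Literature.Computability.Cryptography (IsPPT acceptPMF distAdvantage acceptPMF_true_toReal)

/-- **The length selector.** For strictly monotone `ℓ'` there is `g : ℕ → ℕ` with `g m ≤ m` and
`g (2n + 2 + ℓ' n) = ℓ' n`: the sample length read off the game-input length `|⟨1ⁿ, x⟩|`
(well defined since `n ↦ 2n + 2 + ℓ' n` is injective; `0` off the game-input lengths). -/
theorem exists_lenSel {ℓ' : ℕ → ℕ} (hℓ : StrictMono ℓ') :
    ∃ g : ℕ → ℕ, (∀ m, g m ≤ m) ∧ ∀ n, g (2 * n + 2 + ℓ' n) = ℓ' n := by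
  classical
  refine ⟨fun m => if h : ∃ n, 2 * n + 2 + ℓ' n = m then ℓ' (Classical.choose h) else 0,
    fun m => ?_, fun n => ?_⟩
  · dsimp only
    split_ifs with h
    · have := Classical.choose_spec h
      omega
    · exact Nat.zero_le _
  · have h : ∃ k, 2 * k + 2 + ℓ' k = 2 * n + 2 + ℓ' n := ⟨n, rfl⟩
    have hinj : Function.Injective fun k => 2 * k + 2 + ℓ' k :=
      StrictMono.injective fun a b hab => by
        show 2 * a + 2 + ℓ' a < 2 * b + 2 + ℓ' b
        have := hℓ hab
        omega
    have hk : Classical.choose h = n := hinj (Classical.choose_spec h)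
    dsimp only
    rw [dif_pos h, hk]

/-- **The simulator is PPT when `A` is.** If `D.run z r = A.run (boolUnpair z).2 r` and
`D.coinLen m = A.coinLen (g m)` with `g m ≤ m`, then `D` is PPT: its run is the machine of `A`
after the polynomial-time preprocessing `⟨z, r⟩ ↦ ⟨(boolUnpair z).2, r⟩` (`mapFstFn` of the second
pair projection), and its coin budget at `m` is `A.coinLen (g m) ≤ p (g m) ≤ p m` for the
(monotone) coin polynomial `p` of `A`. -/
theorem isPPT_of_run_eq {A D : RandAlg (List Bool) Bool} {g : ℕ → ℕ}
    (hA : A.IsPolyTime (id : List Bool → List Bool) encodeBool)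
    (hrun : ∀ z r, D.run z r = A.run (boolUnpair z).2 r)
    (hcoin : ∀ m, D.coinLen m = A.coinLen (g m)) (hg : ∀ m, g m ≤ m) :
    IsPPT D encodeBool := by
  refine ⟨?_, ?_⟩
  · have hpre : PolyTimeComputable (fun p : List Bool × List Bool => boolPair (id p.1) p.2)
        (fun p : List Bool × List Bool => boolPair (id p.1) p.2)
        (fun p : List Bool × List Bool => ((boolUnpair p.1).2, p.2)) :=
      PolyTimeComputable.of_encode_eq (f := mapFstFn fun z => (boolUnpair z).2)
        (fun p : List Bool × List Bool => boolPair p.1 p.2) (fun _ => rfl) (fun p => by simp)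
        (mapFstFn_mem_FP boolUnpairSnd_mem_FP)
    have he : Function.uncurry D.run =
        Function.uncurry A.run ∘ fun p : List Bool × List Bool => ((boolUnpair p.1).2, p.2) := by
      funext p
      rcases p with ⟨z, r⟩
      exact hrun z r
    rw [he]
    exact PolyTimeComputable.comp_holds hA.1 hpre
  · obtain ⟨p, hp⟩ := hA.2
    exact ⟨p, fun m => (hcoin m).le.trans ((hp _).trans (polynomial_eval_mono p (hg m)))⟩

/-- Uniform coins pushed through the same reader agree when the coin counts agree. -/
theorem map_uniformVector_congr (f : List Bool → Bool) {k k' : ℕ} (h : k = k') :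
    (PMF.uniformOfFintype (List.Vector Bool k)).map (fun r => f r.toList) =
      (PMF.uniformOfFintype (List.Vector Bool k')).map (fun r => f r.toList) := by
  subst h
  rfl

/-- **The output law of the simulator** on a game input `⟨1ⁿ, x⟩` with `|x| = ℓ' n` is the output
law of `A` on `x` (same reader `r ↦ A.run x r`, same coin count `A.coinLen (ℓ' n)`). -/
theorem outputPMF_of_run_eq {A D : RandAlg (List Bool) Bool} {g ℓ' : ℕ → ℕ}
    (hrun : ∀ z r, D.run z r = A.run (boolUnpair z).2 r)
    (hcoin : ∀ m, D.coinLen m = A.coinLen (g m)) (hg : ∀ n, g (2 * n + 2 + ℓ' n) = ℓ' n)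
    {n : ℕ} {x : List Bool} (hx : x.length = ℓ' n) :
    D.outputPMF id (boolPair (unaryEncodeNat n) x) = A.outputPMF id x := by
  have hrun' : ∀ r, D.run (boolPair (unaryEncodeNat n) x) r = A.run x r := fun r => by
    simp [hrun]
  have hun : (unaryEncodeNat n).length = n := unary_decode_encode_nat n
  have hc : D.coinLen (id (boolPair (unaryEncodeNat n) x)).length = A.coinLen (id x).length := by
    simp only [hcoin, id, length_boolPair, hun, hx, hg]
  unfold RandAlg.outputPMF
  simp only [hrun']
  exact map_uniformVector_congr (A.run x) hc

/-- **Acceptance of the simulator** on a distribution supported on `ℓ' n`-bit strings: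
`Pr[D(1ⁿ, P) = 1] = ∑' x, P(x) · Pr[A(x) = 1]`. -/
theorem acceptPMF_toReal_of_run_eq {A D : RandAlg (List Bool) Bool} {g ℓ' : ℕ → ℕ}
    (hrun : ∀ z r, D.run z r = A.run (boolUnpair z).2 r)
    (hcoin : ∀ m, D.coinLen m = A.coinLen (g m)) (hg : ∀ n, g (2 * n + 2 + ℓ' n) = ℓ' n)
    {n : ℕ} (P : PMF (List Bool)) (hP : ∀ x ∈ P.support, x.length = ℓ' n) :
    (acceptPMF D n P true).toReal = ∑' x : List Bool, (P x).toReal * A.pr id x {b | b = true} := by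
  rw [acceptPMF_true_toReal]
  refine tsum_congr fun x => ?_
  by_cases hx : x ∈ P.support
  · rw [outputPMF_of_run_eq hrun hcoin hg (hP x hx), RandAlg.pr,
      show ({b | b = true} : Set Bool) = {true} from rfl, PMF.toOuterMeasure_apply_singleton]
  · rw [PMF.mem_support_iff, not_not] at hx
    simp [hx]

/-- **The advantage of the simulator is the index-free acceptance gap of `A`.** -/
theorem distAdvantage_of_run_eq {A D : RandAlg (List Bool) Bool} {g ℓ' : ℕ → ℕ}
    (hrun : ∀ z r, D.run z r = A.run (boolUnpair z).2 r)
    (hcoin : ∀ m, D.coinLen m = A.coinLen (g m)) (hg : ∀ n, g (2 * n + 2 + ℓ' n) = ℓ' n)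
    {X Y : Ensemble} (hX : ∀ n, ∀ x ∈ (X n).support, x.length = ℓ' n)
    (hY : ∀ n, ∀ y ∈ (Y n).support, y.length = ℓ' n) (n : ℕ) :
    distAdvantage D X Y n =
      |(∑' x : List Bool, ((X n) x).toReal * A.pr id x {b | b = true}) -
        (∑' x : List Bool, ((Y n) x).toReal * A.pr id x {b | b = true})| := by
  rw [distAdvantage, acceptPMF_toReal_of_run_eq hrun hcoin hg (X n) (hX n),
    acceptPMF_toReal_of_run_eq hrun hcoin hg (Y n) (hY n)]

end ClauseI

/-- **Clause (i) for indistinguishable fixed-length ensembles.** If `X n`, `Y n` are supported on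
`{0,1}^{ℓ' n}` with `ℓ'` strictly monotone and `IsCompIndistinguishable X Y` (tests fed `⟨1ⁿ, x⟩`,
negligible advantage), then every PPT index-free test `A` (`A.IsPolyTime id encodeBool`) has
acceptance gap `|E_{X n}[Pr[A = 1]] - E_{Y n}[Pr[A = 1]]| → 0`: the gap is the advantage of the PPT
simulator `D = ⟨(z, r) ↦ A.run (boolUnpair z).2 r, m ↦ A.coinLen (g m)⟩` for the length selector
`g` of `ClauseI.exists_lenSel` (`ClauseI.distAdvantage_of_run_eq`), which is negligible, in
particular (exponent `0`) tends to `0`. -/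
theorem stub_clauseI : ∀ (X Y : Ensemble) (ℓ' : ℕ → ℕ), StrictMono ℓ' →
    (∀ n, ∀ x ∈ (X n).support, x.length = ℓ' n) → (∀ n, ∀ y ∈ (Y n).support, y.length = ℓ' n) →
    IsCompIndistinguishable X Y →
    ∀ A : RandAlg (List Bool) Bool, A.IsPolyTime (id : List Bool → List Bool) encodeBool →
      Tendsto (fun n : ℕ => |(∑' x : List Bool, ((X n) x).toReal * A.pr id x {b | b = true}) -
        (∑' x : List Bool, ((Y n) x).toReal * A.pr id x {b | b = true})|) atTop (nhds 0) := by
  intro X Y ℓ' hℓ hX hY hXY A hA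
  obtain ⟨g, hg₁, hg₂⟩ := ClauseI.exists_lenSel hℓ
  obtain ⟨D, hrun, hcoin⟩ : ∃ D : RandAlg (List Bool) Bool,
      (∀ z r, D.run z r = A.run (boolUnpair z).2 r) ∧ ∀ m, D.coinLen m = A.coinLen (g m) :=
    ⟨⟨fun z r => A.run (boolUnpair z).2 r, fun m => A.coinLen (g m)⟩, fun _ _ => rfl, fun _ => rfl⟩
  have h0 := hXY D (ClauseI.isPPT_of_run_eq hA hrun hcoin hg₁) 0
  simp only [pow_zero, one_mul] at h0
  refine Tendsto.congr (fun n => ?_) h0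
  exact ClauseI.distAdvantage_of_run_eq hrun hcoin hg₂ hX hY n

end Summit.PneNP.PneNP.Theorems
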